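import Summits.QuantumFields.YangMills.Theorems.UnitScaleTiltProp7Crit93AtMemberOfRow84T3
import Summits.QuantumFields.YangMills.Theorems.UnitScaleTiltProp7Row74AtMemberT3
import Summits.QuantumFields.YangMills.Theorems.UnitScaleTiltProp7SectET3DeltaOneT3PInv
import HarnessLib

/-!
# Route `UnitScaleTilt`, crux «MinimiserStabilityRegPr» (stmt-QuantumFields-19200, stub EX `stub_existenceMinimalOrbit`, route (α)) — «HCRIT93-MEMBER, TWO SLOTS»:
# **THE DISPLAY's ROW `hCrit93′` AT THE T³ MEMBER FROM (111) + THE LATTICE (84) ROW, WITH THE LETTER SLOT `Δ₁ᴾ = Pᴾᵀ(Δ^η + T_J)Pᴾ` AND THE OPERATOR SLOT `Δ^η + T_J` KEPT APART**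

Cell `ym3-torus` (HUMAN RULING D-0037, YM ladder rung R3 — YM₃ on T³, NOT d = 4, NOT Clay; YM gap NOT proved), width seat `ym3-torus-px21` gen 4 (explicit-unit helper; lineage px21 g0∕g2∕g3:
✓`Prop7Crit93OfEq111` (door), ✓`Prop7Crit93AtMemberOfRow84` (assembly, one slot), ✓`Prop7Row84AtEtaSlotMember` ((84) at `Δ^η + T_Jᴾ`), ✓`Prop7ChartConjPInv` (`hchart`, `hXR` eventually)).
THEOREMS ONLY (0 `def`, 0 `sorry`); `--supports stmt-QuantumFields-19200 --as helper`, count-neutral; NO claim on crux ∕ stub ∕ registry.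

WHY (EX display of record S15ᴰ ✓p684527, storey «Sect. C–E»: `hCrit93′` DISPLAYED, no seat; LOCATE-CRIT93-SLOT-px21g2 f775b334 §0).  Print derives (111) from the slice criticality (93) through (84)
and (99)–(110), and every step but (84) is an identity running BACKWARDS (✓`inner_firstOrder_sol_eq_zero`).  At the letters of record the (111)-letters `𝒢f H₁f` sit at the LETTER slot
`Δ_L := DeltaOnePJ = Pᴾᵀ(Δ^η + T_Jᴾ)Pᴾ` ([Balaban1985BackgroundPropagators] (3.127)–(3.128); ✓`DeltaOneP_apply`) while the (84) row (★px21 ✓`hasDerivAt_actionZ_chartRay_real_member_eta_su2`)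
reads the OPERATOR slot `Δ_x := Δ^η + T_Jᴾ` (`DeltaEtaSlot + TJSlotP`, the EX namer's SLOT WORD).  THE BRIDGE (§1): on the pairing of a LANDAU direction with a LANDAU field the two slots
agree — `⟪v′, Δ₁ᴾ v⟫ = ⟪Pᴾv′, (Δ^η + T_J)(Pᴾv)⟫ = ⟪v′, (Δ^η + T_J)v⟫` (✓`inner_DeltaOneP`, ✓`gaugeCorrP_eq_self_of_landau`; [Balaban1985BackgroundPropagators] (3.119), [Balaban1985Variational]
(87) «⟨A′, Δ_πA⟩ = ⟨A′, ΔA⟩» on the Landau subspace); the (111)-value `A′♭ = −𝔊x + Hb` IS Landau (✓`RS_DstarL2_frakGT`, ✓`RS_DstarL2_HT`) and so is the slice direction ((83)).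
SECOND GAP CLOSED (§3): ✓p669617's assembly asked the reality row `hXR` for ALL `t`; the ray's chart value is real only NEAR `t = 0` (★px21 ✓`eventually_isHermitian_trace_zero_chart`), which is
all `deriv … 0` needs (`HasDerivAt.congr_of_eventuallyEq`).

WHAT IS PROVED (member `F`, `n ≤ K`, weights `c₀ cB`, `0 ≤ a`; generic J-term letter `TJ` (record: `TJSlotP`), generic `W` (print's `(δ∕δA′)V`), `Tc` (the (115)-level chart) and `χ`
(the exponent-units chart); ns `…Theorems.Prop7Crit93AtMemberTwoSlot`):
* §1 ★`inner_DeltaOneP_of_landau` — the bridge; `landau_sol111` — the (111)-value `−𝔊x + Hb` is Landau at the letter slot.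
* §2 ★★`deriv_eq_zero_of_eq111_of_h84_twoSlot` (L² currency) and ★★`deriv_eq_zero_of_eq111_of_h84_pair27_twoSlot` ((27)-pairing currency): the door ✓`deriv_eq_zero_of_eq111_of_h84(_pair27)`
  with the (84)-row's middle term at the operator slot `(DeltaEtaSlot + TJ) U₀` and the letters ∕ class ∕ guards at `DeltaOneP TJ`.
* §3 ★★★`deriv_chartRay_eq_zero_of_eq111_twoSlot_ev` — ✓p669617 §2's chart-generic assembly over §2 AT THE SLOTS OF RECORD (`DeltaOnePJ`, `DeltaEtaSlot + TJSlotP`), with `hXR` EVENTUALLY: (111) + `hZ` (the conclusion shape of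
  ✓`hasDerivAt_actionZ_chartRay_real_member_eta_su2`, opaque `W Tc`) + `hchart` (∀ᶠ) + `hXR` (∀ᶠ) ⟹ `deriv (t ↦ wilsonAction4 (e^{(−I)•χ(X + tδ)}·U₀)) 0 = 0` — the display's `hCrit93′`
  conclusion token-for-token once `χ`, `TJ := TJSlotP` are the letters of record (the family door «HCRIT93-FAMILY» is the sequel).
HONEST SCOPE.  Linear algebra + calculus glue over landed letters; the class `PosOnto … (DeltaOneP TJ) U₀`, (111), (84), the chart conjugacy and the reality near `0` are HYPOTHESES with
named suppliers; no estimate of [B11] Sect. C is proved here; not a proof of any stub; nothing continuum ∕ OS ∕ mass-gap ∕ Clay.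

References: T. Bałaban, CMP **102** (1985) 277–309 [Balaban1985Variational] ((82)–(84) p.290, (87) p.291, (93) p.291, (99)–(103) p.293, (110)–(112) p.294); CMP **99** (1985) 389–434
[Balaban1985BackgroundPropagators] ((3.1) p.390, (3.6)–(3.7) p.391, (3.119) p.419, (3.124) p.420, (3.127)–(3.128) p.421).
-/

set_option autoImplicit false

noncomputable section

open scoped InnerProductSpace ComplexConjugate Matrix.Norms.L2Operator BigOperators Topology
open Complex (I)

namespace Summit.QuantumFields.YangMills.Theorems.Prop7Crit93AtMemberTwoSlot

open Literature.MathematicalPhysics.QuantumFieldTheory.Balaban1983to89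
open Literature.MathematicalPhysics.QuantumFieldTheory.Balaban1983to89.T3ContinuumYM3Torus
open NormedSpace (exp)
open B9SectCLatticeCarrier (Bond)
open B9Eq311L2Pairing (WL2)
open B11Eq115Space (NegSize Space115 JetSup NegSup)
open B11Eq111FrakG (nabla115)
open B11Eq103H1Complex (SiteL2K BondL2K funEquiv)
open B11Eq98CurrentSlot (Jcur)
open B11Eq90Transpose (pair27)
open B11Eq90V0primeCurrent (Tsh Ucur curL flat115 flat115_apply)
open B9Eq3119DeltaPiCarrier (currentCLM)
open B9Eq39Adjoint (prodCfg)
open B9Eq31ActionZpow (actionZ)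
open T3SectALandauChart (eta emb15 bgUnits)
open Summit.QuantumFields.YangMills.Theorems.Prop7TPrint (expHermField)
open Summit.QuantumFields.YangMills.Theorems.Prop7SectET3Transport (periodsT3 bondEquiv bgOfCfg)
open Summit.QuantumFields.YangMills.Theorems.Prop7SectET3HilbertLetters (W₂ frobEquiv toL2 toL2B DL2 DstarL2)
open Summit.QuantumFields.YangMills.Theorems.Prop7SectET3GaugeProjector (NS RS RS_isSymmetric)
open Summit.QuantumFields.YangMills.Theorems.Prop7SectET3CurvedPropagators
open Summit.QuantumFields.YangMills.Theorems.Prop7SectET3DeltaPi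
open Summit.QuantumFields.YangMills.Theorems.Prop7SectET3DeltaPiPInv (gaugeCorrP)
open Summit.QuantumFields.YangMills.Theorems.Prop7SectET3DeltaOnePInv (DeltaOneP TJSlotP DeltaOnePJ inner_DeltaOneP DeltaOneP_kills_NS inner_DL2_DeltaOneP_eq_zero)
open Summit.QuantumFields.YangMills.Theorems.Prop7Row74AtMember (gaugeCorrP_eq_self_of_landau)
open Summit.QuantumFields.YangMills.Theorems.Prop7SymAvgTwSym (QTwS CmapTwS)
open Summit.QuantumFields.YangMills.Theorems.Prop7SPrint (IsLandauPrintS)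
open Summit.QuantumFields.YangMills.Theorems.Prop7SectET3WilsonHessian (DeltaEta DeltaEtaSlot DeltaEtaSlot_apply chartU actionRe wilsonAction4_emb15_eq_re)
open Summit.QuantumFields.YangMills.Theorems.Prop7HessRowOfEq111 (toL2_iota_eq111)
open Summit.QuantumFields.YangMills.Theorems.Prop7Crit93OfEq111 (inner_firstOrder_sol_eq_zero Qk_toL2_eq_zero_of_QTwS RS_DstarL2_toL2_eq_zero_of_landau deriv_eq_zero_of_hasDerivAt_re_inner sum_pair27_eq_inner)
open Summit.QuantumFields.YangMills.Theorems.Prop7Crit93AtMemberOfRow84 (wilsonAction4_emb15_expHermField_eq_re)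
open Summit.QuantumFields.YangMills.Theorems.Prop7ActionLatticeTransport (actionZ_chartCfg_eq_actionRe)

variable {F : T3Family} {n K : ℕ} {h : n ≤ K} {c₀ cB a : ℝ} [Fact (0 < c₀)] [Fact (0 < cB)]
  (TJ : GaugeField (F.P K) 0 (Matrix.specialUnitaryGroup (Fin 2) ℂ) → (BondL2K ℂ 3 (periodsT3 F K) c₀ W₂ →ₗ[ℂ] BondL2K ℂ 3 (periodsT3 F K) c₀ W₂))

/-! ## §1 The bridge between the letter slot `Δ₁ᴾ = Pᴾᵀ(Δ^η + T_J)Pᴾ` and the operator slot `Δ^η + T_J` on Landau pairs -/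

/-- ★ **THE TWO-SLOT BRIDGE**: for LANDAU `v′, v` (`R_S(D*v′) = 0 = R_S(D*v)`), `⟪v′, Δ₁ᴾ(T_J) v⟫ = ⟪v′, Δ^η v + T_J v⟫` — `Pᴾ` is the identity on the Landau subspace
([Balaban1985BackgroundPropagators] (3.119), (3.127)–(3.128); [Balaban1985Variational] (87) «⟨A′, Δ_πA⟩ = ⟨A′, ΔA⟩» for Landau `A′, A`).
[cite: Balaban1985BackgroundPropagators, (3.119) p.419, (3.127)-(3.128) p.421; Balaban1985Variational, (87) p.291] -/
theorem inner_DeltaOneP_of_landau (U₀ : GaugeField (F.P K) 0 (Matrix.specialUnitaryGroup (Fin 2) ℂ)) {v' v : BondL2K ℂ 3 (periodsT3 F K) c₀ W₂}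
    (hv' : RS F n K h c₀ cB U₀ (DstarL2 F n K c₀ U₀ v') = 0) (hv : RS F n K h c₀ cB U₀ (DstarL2 F n K c₀ U₀ v) = 0) :
    ⟪v', DeltaOneP F n K h c₀ cB a TJ U₀ v⟫_ℂ = ⟪v', DeltaEta F n K c₀ U₀ v + TJ U₀ v⟫_ℂ := by
  rw [inner_DeltaOneP, gaugeCorrP_eq_self_of_landau (a := a) U₀ hv', gaugeCorrP_eq_self_of_landau (a := a) U₀ hv, inner_add_right]

/-- **THE (111)-VALUE IS LANDAU**: on the class `PosOnto … (Δ₁ᴾ(T_J)) U₀` with the slot's guards, `R_S(D*(−𝔊x + Hb)) = 0` (✓`RS_DstarL2_frakGT`, ✓`RS_DstarL2_HT`: «QG = 0, RD*𝔊 = 0», «RD*H₁B = 0»).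
[cite: Balaban1985Variational, (102)-(103) p.293, (110)-(111) p.294; Balaban1985BackgroundPropagators, (3.124) p.420] -/
theorem landau_sol111 {U₀ : GaugeField (F.P K) 0 (Matrix.specialUnitaryGroup (Fin 2) ℂ)} (hp : PosOnto F n K h c₀ cB a (DeltaOneP F n K h c₀ cB a TJ) U₀)
    (hΔ : ∀ l ∈ NS F n K h c₀ cB U₀, DeltaOneP F n K h c₀ cB a TJ U₀ (DL2 F n K c₀ U₀ l) = 0)
    (hΔ' : ∀ l ∈ NS F n K h c₀ cB U₀, ∀ w, ⟪DL2 F n K c₀ U₀ l, DeltaOneP F n K h c₀ cB a TJ U₀ w⟫_ℂ = 0)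
    (x : BondL2K ℂ 3 (periodsT3 F K) c₀ W₂) (b : WL2 ℂ (fun _ : PBond (F.P n) 0 => cB) W₂) :
    RS F n K h c₀ cB U₀ (DstarL2 F n K c₀ U₀ (-(frakGT F n K h c₀ cB a (DeltaOneP F n K h c₀ cB a TJ) U₀ x) + HT F n K h c₀ cB a (DeltaOneP F n K h c₀ cB a TJ) U₀ b)) = 0 := by
  rw [map_add, map_neg, map_add, map_neg, RS_DstarL2_frakGT hp hΔ hΔ' x, RS_DstarL2_HT hp hΔ' b, neg_zero, zero_add]

/-! ## §2 ★★ The door with two slots -/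

/-- ★★ **`hCrit93′` FROM (111) + (84), TWO SLOTS, `L²` CURRENCY**: the letters ∕ class ∕ guards at `Δ_L := Δ₁ᴾ(T_J)`, the (84)-row's Hessian term at the OPERATOR slot `(Δ^η + T_J)(U₀)`:
from (111) `A₁ + 𝒢f J + 𝒢f W = 0`, a slice direction `δ` (`QTwS U₀ δ = 0`, Landau) and «`f` has derivative `re(κ·⟪toL2 δ, (Ĵ + Ŵ) + (Δ^η + T_J)(U₀)(toL2 A′♭)⟫)` at `0`» conclude `deriv f 0 = 0`.
[cite: Balaban1985Variational, (84) p.290, (87) p.291, (93) p.291, (99) p.293, (111) p.294; Balaban1985BackgroundPropagators, (3.127)-(3.128) p.421] -/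
theorem deriv_eq_zero_of_eq111_of_h84_twoSlot [Fact (0 < (F.L : ℝ))] [Fact (0 < ((F.L : ℝ)⁻¹) ^ (K - n))]
    {U₀ : GaugeField (F.P K) 0 (Matrix.specialUnitaryGroup (Fin 2) ℂ)} (hp : PosOnto F n K h c₀ cB a (DeltaOneP F n K h c₀ cB a TJ) U₀)
    (hΔ : ∀ l ∈ NS F n K h c₀ cB U₀, DeltaOneP F n K h c₀ cB a TJ U₀ (DL2 F n K c₀ U₀ l) = 0)
    (hΔ' : ∀ l ∈ NS F n K h c₀ cB U₀, ∀ w, ⟪DL2 F n K c₀ U₀ l, DeltaOneP F n K h c₀ cB a TJ U₀ w⟫_ℂ = 0)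
    (A₁ : Space115 (F.L : ℝ) (((F.L : ℝ)⁻¹) ^ (K - n)) (fun _ : Bond 3 (periodsT3 F K) => K - n) (fun _ : Bond 3 (periodsT3 F K) × Fin 3 => K - n)
      (nabla115 (((F.L : ℝ)⁻¹) ^ (K - n)) (bgOfCfg F K U₀)))
    (J W : NegSize (F.L : ℝ) (((F.L : ℝ)⁻¹) ^ (K - n)) (fun _ : Bond 3 (periodsT3 F K) => K - n) 3 (Matrix (Fin 2) (Fin 2) ℂ))
    (B : PBond (F.P n) 0 → Matrix (Fin 2) (Fin 2) ℂ)
    (heq : A₁ + frakGfR F n K h c₀ cB a (DeltaOneP F n K h c₀ cB a TJ) U₀ J + frakGfR F n K h c₀ cB a (DeltaOneP F n K h c₀ cB a TJ) U₀ W = 0)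
    {δ : PBond (F.P K) 0 → Matrix (Fin 2) (Fin 2) ℂ} (hδQ : QTwS F n K h U₀ δ = 0) (hδL : IsLandauPrintS F n K h c₀ cB U₀ δ)
    {f : ℝ → ℝ} {κ : ℂ}
    (h84 : HasDerivAt f (RCLike.re (κ * ⟪toL2 F K c₀ δ,
        (funEquiv frobEquiv (fun _ : Bond 3 (periodsT3 F K) => c₀)).symm (NegSup.equiv _ _ J + NegSup.equiv _ _ W)
          + (DeltaEtaSlot F n K c₀ + TJ) U₀ (toL2 F K c₀ ((fun b : PBond (F.P K) 0 => JetSup.equiv _ _ _ A₁ (bondEquiv F K b))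
              + (fun b : PBond (F.P K) 0 => JetSup.equiv _ _ _ (H1f F n K h c₀ cB a (DeltaOneP F n K h c₀ cB a TJ) U₀ B) (bondEquiv F K b))))⟫_ℂ)) 0) :
    deriv f 0 = 0 := by
  have hfun : ((fun b : PBond (F.P K) 0 => JetSup.equiv _ _ _ A₁ (bondEquiv F K b))
        + (fun b : PBond (F.P K) 0 => JetSup.equiv _ _ _ (H1f F n K h c₀ cB a (DeltaOneP F n K h c₀ cB a TJ) U₀ B) (bondEquiv F K b)))
      = fun b : PBond (F.P K) 0 => JetSup.equiv _ _ _ (A₁ + H1f F n K h c₀ cB a (DeltaOneP F n K h c₀ cB a TJ) U₀ B) (bondEquiv F K b) := by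
    funext b
    rfl
  rw [hfun, toL2_iota_eq111 U₀ A₁ J W B heq] at h84
  set x : BondL2K ℂ 3 (periodsT3 F K) c₀ W₂ := (funEquiv frobEquiv (fun _ : Bond 3 (periodsT3 F K) => c₀)).symm (NegSup.equiv _ _ J + NegSup.equiv _ _ W) with hx
  set Y : BondL2K ℂ 3 (periodsT3 F K) c₀ W₂ := -(frakGT F n K h c₀ cB a (DeltaOneP F n K h c₀ cB a TJ) U₀ x) + HT F n K h c₀ cB a (DeltaOneP F n K h c₀ cB a TJ) U₀ (toL2B F n cB B)
    with hY
  have hδ' := RS_DstarL2_toL2_eq_zero_of_landau U₀ hδL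
  have hYL := landau_sol111 TJ hp hΔ hΔ' x (toL2B F n cB B)
  -- (99) at the letter slot, then the bridge to the operator slot
  have h0 := inner_firstOrder_sol_eq_zero hp hΔ hΔ' x (toL2B F n cB B) (Qk_toL2_eq_zero_of_QTwS U₀ hδQ) hδ'
  have hb : ⟪toL2 F K c₀ δ, ((DeltaEtaSlot F n K c₀ + TJ) U₀) Y⟫_ℂ = ⟪toL2 F K c₀ δ, DeltaOneP F n K h c₀ cB a TJ U₀ Y⟫_ℂ := by
    rw [inner_DeltaOneP_of_landau TJ U₀ hδ' hYL, Pi.add_apply, LinearMap.add_apply, DeltaEtaSlot_apply]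
  have hb' : ⟪((DeltaEtaSlot F n K c₀ + TJ) U₀) Y, toL2 F K c₀ δ⟫_ℂ = ⟪DeltaOneP F n K h c₀ cB a TJ U₀ Y, toL2 F K c₀ δ⟫_ℂ := by
    rw [← inner_conj_symm, hb, inner_conj_symm]
  have key : ⟪x + (DeltaEtaSlot F n K c₀ + TJ) U₀ Y, toL2 F K c₀ δ⟫_ℂ = 0 := by
    rw [inner_add_left] at h0 ⊢
    rw [hb']
    exact h0
  exact deriv_eq_zero_of_hasDerivAt_re_inner key h84

/-- ★★ **`hCrit93′` FROM (111) + THE LATTICE (84) ROW, TWO SLOTS, (27)-PAIRING CURRENCY** — §2's door with `h84` stated as lit ✓`hasDerivAt_actionZ_chartRay_real` concludes it (★px21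
✓`hasDerivAt_actionZ_chartRay_real_member_eta_su2`'s shape): «`f` has derivative `re(κ·(⟨δ′, J⟩ + ⟨δ′, (Δ^η + T_J)^A′⟩ + ⟨δ′, W⟩))` at `0`», the middle current READ AT THE OPERATOR SLOT
`(DeltaEtaSlot + TJ) U₀`, `A′ := A₁ + H₁f B̃` with `H₁f` at the letter slot, `ιδ′` Hermitian on the slice. [cite: Balaban1985Variational, (84) p.290, (87) p.291, (93) p.291, (99) p.293, (111) p.294] -/
theorem deriv_eq_zero_of_eq111_of_h84_pair27_twoSlot [Fact (0 < (F.L : ℝ))] [Fact (0 < ((F.L : ℝ)⁻¹) ^ (K - n))]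
    {U₀ : GaugeField (F.P K) 0 (Matrix.specialUnitaryGroup (Fin 2) ℂ)} (hp : PosOnto F n K h c₀ cB a (DeltaOneP F n K h c₀ cB a TJ) U₀)
    (hΔ : ∀ l ∈ NS F n K h c₀ cB U₀, DeltaOneP F n K h c₀ cB a TJ U₀ (DL2 F n K c₀ U₀ l) = 0)
    (hΔ' : ∀ l ∈ NS F n K h c₀ cB U₀, ∀ w, ⟪DL2 F n K c₀ U₀ l, DeltaOneP F n K h c₀ cB a TJ U₀ w⟫_ℂ = 0)
    (A₁ : Space115 (F.L : ℝ) (((F.L : ℝ)⁻¹) ^ (K - n)) (fun _ : Bond 3 (periodsT3 F K) => K - n) (fun _ : Bond 3 (periodsT3 F K) × Fin 3 => K - n)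
      (nabla115 (((F.L : ℝ)⁻¹) ^ (K - n)) (bgOfCfg F K U₀)))
    (J W : NegSize (F.L : ℝ) (((F.L : ℝ)⁻¹) ^ (K - n)) (fun _ : Bond 3 (periodsT3 F K) => K - n) 3 (Matrix (Fin 2) (Fin 2) ℂ))
    (B : PBond (F.P n) 0 → Matrix (Fin 2) (Fin 2) ℂ)
    (heq : A₁ + frakGfR F n K h c₀ cB a (DeltaOneP F n K h c₀ cB a TJ) U₀ J + frakGfR F n K h c₀ cB a (DeltaOneP F n K h c₀ cB a TJ) U₀ W = 0)
    {δ' : Space115 (F.L : ℝ) (((F.L : ℝ)⁻¹) ^ (K - n)) (fun _ : Bond 3 (periodsT3 F K) => K - n) (fun _ : Bond 3 (periodsT3 F K) × Fin 3 => K - n)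
      (nabla115 (((F.L : ℝ)⁻¹) ^ (K - n)) (bgOfCfg F K U₀))}
    (hδR : ∀ b : PBond (F.P K) 0, star (JetSup.equiv _ _ _ δ' (bondEquiv F K b)) = JetSup.equiv _ _ _ δ' (bondEquiv F K b))
    (hδQ : QTwS F n K h U₀ (fun b : PBond (F.P K) 0 => JetSup.equiv _ _ _ δ' (bondEquiv F K b)) = 0)
    (hδL : IsLandauPrintS F n K h c₀ cB U₀ (fun b : PBond (F.P K) 0 => JetSup.equiv _ _ _ δ' (bondEquiv F K b)))
    {f : ℝ → ℝ} {κ : ℂ}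
    (h84 : HasDerivAt f (RCLike.re (κ * (pair27 (LinearMap.toContinuousLinearMap (Matrix.traceLinearMap (Fin 2) ℂ ℂ)) J (flat115 δ')
      + pair27 (LinearMap.toContinuousLinearMap (Matrix.traceLinearMap (Fin 2) ℂ ℂ))
          (currentCLM frobEquiv (fun _ : Bond 3 (periodsT3 F K) × Fin 3 => K - n) (nabla115 (((F.L : ℝ)⁻¹) ^ (K - n)) (bgOfCfg F K U₀)) ((DeltaEtaSlot F n K c₀ + TJ) U₀)
            (A₁ + H1f F n K h c₀ cB a (DeltaOneP F n K h c₀ cB a TJ) U₀ B)) (flat115 δ')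
      + pair27 (LinearMap.toContinuousLinearMap (Matrix.traceLinearMap (Fin 2) ℂ ℂ)) W (flat115 δ')))) 0) :
    deriv f 0 = 0 := by
  have hstar : star (fun b : PBond (F.P K) 0 => JetSup.equiv _ _ _ δ' (bondEquiv F K b)) = fun b : PBond (F.P K) 0 => JetSup.equiv _ _ _ δ' (bondEquiv F K b) :=
    funext fun b => hδR b
  rw [sum_pair27_eq_inner, hstar, ← mul_assoc, ← mul_assoc] at h84
  have hfun : ((fun b : PBond (F.P K) 0 => JetSup.equiv _ _ _ A₁ (bondEquiv F K b))
        + (fun b : PBond (F.P K) 0 => JetSup.equiv _ _ _ (H1f F n K h c₀ cB a (DeltaOneP F n K h c₀ cB a TJ) U₀ B) (bondEquiv F K b)))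
      = fun b : PBond (F.P K) 0 => JetSup.equiv _ _ _ (A₁ + H1f F n K h c₀ cB a (DeltaOneP F n K h c₀ cB a TJ) U₀ B) (bondEquiv F K b) := by
    funext b
    rfl
  rw [← hfun] at h84
  exact deriv_eq_zero_of_eq111_of_h84_twoSlot TJ hp hΔ hΔ' A₁ J W B heq hδQ hδL h84

/-! ## §3 ★★★ The assembly: `hCrit93′` at the member from (111) + `hZ` + `hchart` + `hXR` (both eventually), two slots, chart-generic -/

/-- ★★★ **THE DISPLAY's `hCrit93′` MEMBER TEXT FROM (111) + THE LATTICE (84), TWO SLOTS, `hXR` EVENTUALLY.**  Letters `𝒢f H₁f` at `Δ_L := Δ₁ᴾ(T_J)` on the class `PosOnto … (Δ₁ᴾ(T_J)) U₀`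
(`0 ≤ a` gives the guards, ✓`DeltaOneP_kills_NS`∕✓`inner_DL2_DeltaOneP_eq_zero`); the knit's (111); a slice direction `δ′` (`ιδ′` Hermitian, `QTwS`-null, Landau) read as `δ` in the ray through
`hchart`; **`hZ`** = lit (84) along `Tc(A′ + tδ′)` with the Hessian current AT `(Δ^η + T_J)(U₀)` (★px21 ✓`hasDerivAt_actionZ_chartRay_real_member_eta_su2`'s conclusion shape; `W Tc` opaque);
**`hchart`** = chart conjugacy near `t = 0` (★px21 ✓`eventually_smul_iota_T47_eq_chart_pinv`); **`hXR`** = reality of the chart value NEAR `t = 0` (★px21 ✓`eventually_isHermitian_trace_zero_chart`)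
⟹ `deriv (t ↦ wilsonAction4 (e^{(−I)•χ(κ_f•ιA′ + tδ)}·U₀)) 0 = 0`.  Proof = ✓p669617 §2 with `funext` replaced by an eventual equality, over §2's two-slot door (`κ := η∕2`).
[cite: Balaban1985Variational, (84) p.290, (87) p.291, (93) p.291, (99) p.293, (111)-(112) p.294; Balaban1985BackgroundPropagators, (3.1) p.390, (3.6)-(3.7) p.391, (3.127)-(3.128) p.421] -/
theorem deriv_chartRay_eq_zero_of_eq111_twoSlot_ev [Fact (0 < (F.L : ℝ))] [Fact (0 < ((F.L : ℝ)⁻¹) ^ (K - n))] (ha : 0 ≤ a)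
    {U₀ : GaugeField (F.P K) 0 (Matrix.specialUnitaryGroup (Fin 2) ℂ)} (hp : PosOnto F n K h c₀ cB a (DeltaOnePJ F n K h c₀ cB a) U₀)
    (A₁ : Space115 (F.L : ℝ) (((F.L : ℝ)⁻¹) ^ (K - n)) (fun _ : Bond 3 (periodsT3 F K) => K - n) (fun _ : Bond 3 (periodsT3 F K) × Fin 3 => K - n)
      (nabla115 (((F.L : ℝ)⁻¹) ^ (K - n)) (bgOfCfg F K U₀)))
    (W : Space115 (F.L : ℝ) (((F.L : ℝ)⁻¹) ^ (K - n)) (fun _ : Bond 3 (periodsT3 F K) => K - n) (fun _ : Bond 3 (periodsT3 F K) × Fin 3 => K - n)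
        (nabla115 (((F.L : ℝ)⁻¹) ^ (K - n)) (bgOfCfg F K U₀)) →
      NegSize (F.L : ℝ) (((F.L : ℝ)⁻¹) ^ (K - n)) (fun _ : Bond 3 (periodsT3 F K) => K - n) 3 (Matrix (Fin 2) (Fin 2) ℂ))
    (Tc : Space115 (F.L : ℝ) (((F.L : ℝ)⁻¹) ^ (K - n)) (fun _ : Bond 3 (periodsT3 F K) => K - n) (fun _ : Bond 3 (periodsT3 F K) × Fin 3 => K - n)
        (nabla115 (((F.L : ℝ)⁻¹) ^ (K - n)) (bgOfCfg F K U₀)) →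
      Space115 (F.L : ℝ) (((F.L : ℝ)⁻¹) ^ (K - n)) (fun _ : Bond 3 (periodsT3 F K) => K - n) (fun _ : Bond 3 (periodsT3 F K) × Fin 3 => K - n)
        (nabla115 (((F.L : ℝ)⁻¹) ^ (K - n)) (bgOfCfg F K U₀)))
    (B : PBond (F.P n) 0 → Matrix (Fin 2) (Fin 2) ℂ)
    (heq : A₁ + frakGfR F n K h c₀ cB a (DeltaOnePJ F n K h c₀ cB a) U₀ (Jcur (bgOfCfg F K U₀))
      + frakGfR F n K h c₀ cB a (DeltaOnePJ F n K h c₀ cB a) U₀ (W (A₁ + H1f F n K h c₀ cB a (DeltaOnePJ F n K h c₀ cB a) U₀ B)) = 0)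
    (χ : (PBond (F.P K) 0 → Matrix (Fin 2) (Fin 2) ℂ) → (PBond (F.P K) 0 → Matrix (Fin 2) (Fin 2) ℂ)) (δ : PBond (F.P K) 0 → Matrix (Fin 2) (Fin 2) ℂ)
    {δ' : Space115 (F.L : ℝ) (((F.L : ℝ)⁻¹) ^ (K - n)) (fun _ : Bond 3 (periodsT3 F K) => K - n) (fun _ : Bond 3 (periodsT3 F K) × Fin 3 => K - n)
      (nabla115 (((F.L : ℝ)⁻¹) ^ (K - n)) (bgOfCfg F K U₀))}
    (hδR : ∀ b : PBond (F.P K) 0, star (JetSup.equiv _ _ _ δ' (bondEquiv F K b)) = JetSup.equiv _ _ _ δ' (bondEquiv F K b))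
    (hδQ : QTwS F n K h U₀ (fun b : PBond (F.P K) 0 => JetSup.equiv _ _ _ δ' (bondEquiv F K b)) = 0)
    (hδL : IsLandauPrintS F n K h c₀ cB U₀ (fun b : PBond (F.P K) 0 => JetSup.equiv _ _ _ δ' (bondEquiv F K b)))
    (hZ : HasDerivAt (fun t : ℝ => actionZ Tsh (((F.L : ℝ)⁻¹) ^ (K - n)) 3
        ((LinearMap.toContinuousLinearMap (Matrix.traceLinearMap (Fin 2) ℂ ℂ) : Matrix (Fin 2) (Fin 2) ℂ →L[ℂ] ℂ) : Matrix (Fin 2) (Fin 2) ℂ →ₗ[ℂ] ℂ)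
        (prodCfg (Ucur (bgOfCfg F K U₀)) (((F.L : ℝ)⁻¹) ^ (K - n)) (curL (flat115 (Tc (A₁ + H1f F n K h c₀ cB a (DeltaOnePJ F n K h c₀ cB a) U₀ B + (t : ℂ) • δ'))))))
      (pair27 (LinearMap.toContinuousLinearMap (Matrix.traceLinearMap (Fin 2) ℂ ℂ)) (Jcur (bgOfCfg F K U₀) : NegSize (F.L : ℝ) (((F.L : ℝ)⁻¹) ^ (K - n)) (fun _ : Bond 3 (periodsT3 F K) => K - n) 3 (Matrix (Fin 2) (Fin 2) ℂ)) (flat115 δ')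
        + pair27 (LinearMap.toContinuousLinearMap (Matrix.traceLinearMap (Fin 2) ℂ ℂ))
            (currentCLM frobEquiv (fun _ : Bond 3 (periodsT3 F K) × Fin 3 => K - n) (nabla115 (((F.L : ℝ)⁻¹) ^ (K - n)) (bgOfCfg F K U₀)) ((DeltaEtaSlot F n K c₀ + TJSlotP F n K h c₀ cB a) U₀)
              (A₁ + H1f F n K h c₀ cB a (DeltaOnePJ F n K h c₀ cB a) U₀ B))
            (flat115 δ')
        + pair27 (LinearMap.toContinuousLinearMap (Matrix.traceLinearMap (Fin 2) ℂ ℂ)) (W (A₁ + H1f F n K h c₀ cB a (DeltaOnePJ F n K h c₀ cB a) U₀ B)) (flat115 δ')) 0)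
    (hchart : ∀ᶠ t : ℝ in nhds 0,
      ((((eta F n K : ℝ) : ℂ)) * Complex.I) • (fun b : PBond (F.P K) 0 => JetSup.equiv _ _ _ (Tc (A₁ + H1f F n K h c₀ cB a (DeltaOnePJ F n K h c₀ cB a) U₀ B + (t : ℂ) • δ')) (bondEquiv F K b))
        = χ (((((eta F n K : ℝ) : ℂ)) * Complex.I) • ((fun b : PBond (F.P K) 0 => JetSup.equiv _ _ _ A₁ (bondEquiv F K b))
              + (fun b : PBond (F.P K) 0 => JetSup.equiv _ _ _ (H1f F n K h c₀ cB a (DeltaOnePJ F n K h c₀ cB a) U₀ B) (bondEquiv F K b))) + (t : ℂ) • δ))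
    (hXR : ∀ᶠ t : ℝ in nhds 0, ∀ b' : PBond (F.P K) 0,
      (((-Complex.I) • χ (((((eta F n K : ℝ) : ℂ)) * Complex.I) • ((fun b : PBond (F.P K) 0 => JetSup.equiv _ _ _ A₁ (bondEquiv F K b))
              + (fun b : PBond (F.P K) 0 => JetSup.equiv _ _ _ (H1f F n K h c₀ cB a (DeltaOnePJ F n K h c₀ cB a) U₀ B) (bondEquiv F K b))) + (t : ℂ) • δ)) b').IsHermitian ∧
      Matrix.trace (((-Complex.I) • χ (((((eta F n K : ℝ) : ℂ)) * Complex.I) • ((fun b : PBond (F.P K) 0 => JetSup.equiv _ _ _ A₁ (bondEquiv F K b))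
              + (fun b : PBond (F.P K) 0 => JetSup.equiv _ _ _ (H1f F n K h c₀ cB a (DeltaOnePJ F n K h c₀ cB a) U₀ B) (bondEquiv F K b))) + (t : ℂ) • δ)) b') = 0) :
    deriv (fun t : ℝ => wilsonAction4 (emb15 U₀ (expHermField (fun b' : PBond (F.P K) 0 => (-Complex.I) •
      (χ (((((eta F n K : ℝ) : ℂ)) * Complex.I) • ((fun b : PBond (F.P K) 0 => JetSup.equiv _ _ _ A₁ (bondEquiv F K b))
          + (fun b : PBond (F.P K) 0 => JetSup.equiv _ _ _ (H1f F n K h c₀ cB a (DeltaOnePJ F n K h c₀ cB a) U₀ B) (bondEquiv F K b))) + (t : ℂ) • δ)) b')))) 0 = 0 := by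
  -- abbreviations
  set X : PBond (F.P K) 0 → Matrix (Fin 2) (Fin 2) ℂ := ((((eta F n K : ℝ) : ℂ)) * Complex.I) •
    ((fun b : PBond (F.P K) 0 => JetSup.equiv _ _ _ A₁ (bondEquiv F K b))
      + (fun b : PBond (F.P K) 0 => JetSup.equiv _ _ _ (H1f F n K h c₀ cB a (DeltaOnePJ F n K h c₀ cB a) U₀ B) (bondEquiv F K b)))
    with hX
  set g : ℝ → ℂ := fun t => actionRe F K (chartU F K U₀ (χ (X + (t : ℂ) • δ))) with hg
  have hηpos : (0 : ℝ) < eta F n K := T3SectALandauChart.eta_pos F n K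
  have hηne : (((eta F n K : ℝ) : ℂ)) ≠ 0 := Complex.ofReal_ne_zero.2 hηpos.ne'
  -- (act) + hchart: near `t = 0`, lit's `actionZ` along the lattice ray is `η⁻¹·2·g t`
  have hZ' : HasDerivAt (fun t : ℝ => (((eta F n K : ℝ) : ℂ))⁻¹ * (2 * g t))
      (pair27 (LinearMap.toContinuousLinearMap (Matrix.traceLinearMap (Fin 2) ℂ ℂ)) (Jcur (bgOfCfg F K U₀) : NegSize (F.L : ℝ) (((F.L : ℝ)⁻¹) ^ (K - n)) (fun _ : Bond 3 (periodsT3 F K) => K - n) 3 (Matrix (Fin 2) (Fin 2) ℂ)) (flat115 δ')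
        + pair27 (LinearMap.toContinuousLinearMap (Matrix.traceLinearMap (Fin 2) ℂ ℂ))
            (currentCLM frobEquiv (fun _ : Bond 3 (periodsT3 F K) × Fin 3 => K - n) (nabla115 (((F.L : ℝ)⁻¹) ^ (K - n)) (bgOfCfg F K U₀)) ((DeltaEtaSlot F n K c₀ + TJSlotP F n K h c₀ cB a) U₀)
              (A₁ + H1f F n K h c₀ cB a (DeltaOnePJ F n K h c₀ cB a) U₀ B))
            (flat115 δ')
        + pair27 (LinearMap.toContinuousLinearMap (Matrix.traceLinearMap (Fin 2) ℂ ℂ)) (W (A₁ + H1f F n K h c₀ cB a (DeltaOnePJ F n K h c₀ cB a) U₀ B)) (flat115 δ')) 0 := by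
    refine hZ.congr_of_eventuallyEq ?_
    filter_upwards [hchart] with t ht
    have hact := actionZ_chartCfg_eq_actionRe (F := F) (K := K) U₀ (eta F n K) (Tc (A₁ + H1f F n K h c₀ cB a (DeltaOnePJ F n K h c₀ cB a) U₀ B + (t : ℂ) • δ'))
    rw [ht] at hact
    exact hact.symm
  -- undo the constant `2η⁻¹`
  have hg' := hZ'.const_mul ((((eta F n K : ℝ) : ℂ)) / 2)
  have hgfun : (fun t : ℝ => (((eta F n K : ℝ) : ℂ)) / 2 * ((((eta F n K : ℝ) : ℂ))⁻¹ * (2 * g t))) = g := by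
    funext t
    field_simp
  rw [hgfun] at hg'
  -- the ray NEAR `t = 0`: `f t = (g t).re`
  have hf : (fun t : ℝ => wilsonAction4 (emb15 U₀ (expHermField (fun b' : PBond (F.P K) 0 => (-Complex.I) • (χ (X + (t : ℂ) • δ)) b'))))
      =ᶠ[nhds 0] fun t : ℝ => (g t).re := by
    filter_upwards [hXR] with t ht
    refine (wilsonAction4_emb15_expHermField_eq_re U₀ ht).trans ?_
    congr 3
    funext b
    simp only [Pi.smul_apply, smul_smul, mul_neg, Complex.I_mul_I, neg_neg, one_smul]
  have h84 : HasDerivAt (fun t : ℝ => wilsonAction4 (emb15 U₀ (expHermField (fun b' : PBond (F.P K) 0 => (-Complex.I) • (χ (X + (t : ℂ) • δ)) b'))))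
      (RCLike.re (((((eta F n K : ℝ) : ℂ)) / 2) *
        (pair27 (LinearMap.toContinuousLinearMap (Matrix.traceLinearMap (Fin 2) ℂ ℂ)) (Jcur (bgOfCfg F K U₀) : NegSize (F.L : ℝ) (((F.L : ℝ)⁻¹) ^ (K - n)) (fun _ : Bond 3 (periodsT3 F K) => K - n) 3 (Matrix (Fin 2) (Fin 2) ℂ)) (flat115 δ')
        + pair27 (LinearMap.toContinuousLinearMap (Matrix.traceLinearMap (Fin 2) ℂ ℂ))
            (currentCLM frobEquiv (fun _ : Bond 3 (periodsT3 F K) × Fin 3 => K - n) (nabla115 (((F.L : ℝ)⁻¹) ^ (K - n)) (bgOfCfg F K U₀)) ((DeltaEtaSlot F n K c₀ + TJSlotP F n K h c₀ cB a) U₀)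
              (A₁ + H1f F n K h c₀ cB a (DeltaOnePJ F n K h c₀ cB a) U₀ B))
            (flat115 δ')
        + pair27 (LinearMap.toContinuousLinearMap (Matrix.traceLinearMap (Fin 2) ℂ ℂ)) (W (A₁ + H1f F n K h c₀ cB a (DeltaOnePJ F n K h c₀ cB a) U₀ B)) (flat115 δ')))) 0 := by
    refine HasDerivAt.congr_of_eventuallyEq ?_ hf
    have hre := (Complex.reCLM.hasFDerivAt.comp_hasDerivAt (0 : ℝ) hg')
    simpa only [Function.comp_def, Complex.reCLM_apply, RCLike.re_to_complex] using hre
  -- `Δ₁ᴾ` of record is `DeltaOneP T_Jᴾ` by definition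
  unfold DeltaOnePJ at hp heq h84
  exact deriv_eq_zero_of_eq111_of_h84_pair27_twoSlot (TJSlotP F n K h c₀ cB a) hp (DeltaOneP_kills_NS (TJSlotP F n K h c₀ cB a) ha)
    (inner_DL2_DeltaOneP_eq_zero (TJSlotP F n K h c₀ cB a) ha) A₁ (Jcur (bgOfCfg F K U₀))
    (W (A₁ + H1f F n K h c₀ cB a (DeltaOneP F n K h c₀ cB a (TJSlotP F n K h c₀ cB a)) U₀ B)) B heq hδR hδQ hδL h84

end Summit.QuantumFields.YangMills.Theorems.Prop7Crit93AtMemberTwoSlot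

end
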